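import Summits.NavierStokesRegularity.OSWSelfSimilar.SheetRCertificateAssembly
import Summits.NavierStokesRegularity.OSWSelfSimilar.SheetRWeakZeroParityAE
import Summits.NavierStokesRegularity.OSWSelfSimilar.SheetRVelocityEndpointClass
import HarnessLib

/-!
# SHEET-ℝ frame, MODEL ASSEMBLY layer 4c: from the assembled fixed point to the weak profile equation (W) and the MODEL blow-up

HONEST FRAMING (cell ns-blowup GROUP B / zone Z3, case Z3-SR-CERT; 1-D MODEL certificate (viscous gCLM/OSW sheet on the line at
`(a, c_l, ε) = (1/5, 1/2, 1)`); computer-assisted; not Euler/NS; «violates: none — MODEL»).  As in layer 4b, the interval arithmetic of record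
((C2)/(C3): a right inverse `M` of `1 − S₀∘P` with its `K_w` bound; the residual bound `eta`; `S₀` a solution operator of `B_λ`, which exists under (C1)) enters as
HYPOTHESES; in addition the residual class
`g₀ ∈ L²_w` must REPRESENT `G(Ω̄)` weakly (`hres`: `∫ g₀ψ = ∫ F(Ω̄)ψ + ∫ Ω̄₁ψ′` on odd `C_c^∞` tests — one integration by parts for the smooth
centre of record).  What is kernel-checked is the passage
  fixed point (layer 4b) ⇒ linearised weak equation on compactly supported energy tests ⇒ (testing with `(ψ/w, (ψ/w)′)` for odd `ψ ∈ C_c^∞`,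
  `isCompactTest_of_smooth_odd`, `linForm_smooth_test`) the hypothesis `hlin` of `SheetRWeakPairingExpansion.weakZero_of_linearised` ⇒ the weak
  profile equation (W) for `Ω* = Ω̄ + δ` against odd tests (`weakZero_of_linearised_weak_eq`) ⇒ (`SheetRWeakZeroParity.exact_viscous_selfSimilar_blowup_of_weakDeriv_odd`,
  continuity) `Ω* ∈ C²` and the exact self-similar solution of the viscous gCLM MODEL with profile `Ω*` blows up at every `T > 0`, provided
  `Ω* ≢ 0`, which `|Ω̄(X₀)| > (√2/8)·rE` at one point guarantees (`modelBlowup_of_certificate`).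
No definition, no named fact.  WHAT THIS IS NOT: not NS — a statement about a 1-D MODEL equation, conditional on the certificate's interval
arithmetic; «a certified MODEL profile is not an NS blow-up».
-/

noncomputable section

namespace Summit.NavierStokesRegularity.OSWSelfSimilar
namespace SheetRCertificateWeakZero

open _root_.MeasureTheory _root_.Set _root_.Filter _root_.Real _root_.Metric _root_.Function Literature.Analysis.Fourier
  Literature.Analysis.FluidPDE SheetRWeakProfilePV SheetRWeakToStrong SheetREnergyClass SheetRWeightedMeasure SheetREnergySpace
  SheetRLinearisedTests SheetRSolutionOperator SheetRAssemblyOperators SheetRCertificateAssembly SheetRWeakPairingExpansion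
  CertificateViscousSheetR
open scoped Topology ENNReal ContDiff

/-! ### §1 Odd `C_c^∞` functions as compactly supported energy tests: `ψ ↦ (ψ/w, (ψ/w)′)` -/

section Tests

variable {L : ℝ} (hL : 0 < L)
include hL

/-- `(ψ/w)′ = ψ′/w − 2ξψ/w²`, `w = L² + ξ²`. [folklore] -/
theorem hasDerivAt_div_weight {ψ : ℝ → ℝ} (hψ : ContDiff ℝ ∞ ψ) (ξ : ℝ) :
    HasDerivAt (fun x => ψ x / (L ^ 2 + x ^ 2)) (deriv ψ ξ / (L ^ 2 + ξ ^ 2) - 2 * ξ * ψ ξ / (L ^ 2 + ξ ^ 2) ^ 2) ξ := by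
  have hψ1 : ContDiff ℝ 1 ψ := hψ.of_le (by exact_mod_cast le_top)
  have hψ' : HasDerivAt ψ (deriv ψ ξ) ξ := ((hψ1.differentiable one_ne_zero) ξ).hasDerivAt
  have h2 : HasDerivAt (fun x : ℝ => x ^ 2) (2 * ξ) ξ := by simpa using hasDerivAt_pow 2 ξ
  have hw : HasDerivAt (fun x : ℝ => L ^ 2 + x ^ 2) (2 * ξ) ξ := by simpa using h2.const_add (L ^ 2)
  have hne : (L ^ 2 + ξ ^ 2) ≠ 0 := by positivity
  refine (hψ'.div hw hne).congr_deriv ?_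
  rw [div_sub_div _ _ hne (pow_ne_zero 2 hne), div_eq_div_iff (pow_ne_zero 2 hne) (mul_ne_zero hne (pow_ne_zero 2 hne))]
  ring

/-- **An odd `C_c^∞` function gives a compactly supported test** `(ψ/w, (ψ/w)′)` (`IsCompactTest`). [folklore] -/
theorem isCompactTest_of_smooth_odd {ψ : ℝ → ℝ} (hψ : ContDiff ℝ ∞ ψ) (hψc : HasCompactSupport ψ) (hodd : ∀ y, ψ (-y) = -ψ y) :
    IsCompactTest (fun ξ => ψ ξ / (L ^ 2 + ξ ^ 2)) (fun ξ => deriv ψ ξ / (L ^ 2 + ξ ^ 2) - 2 * ξ * ψ ξ / (L ^ 2 + ξ ^ 2) ^ 2) := by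
  have hd := hasDerivAt_div_weight hL hψ
  have hψc' : Continuous ψ := hψ.continuous
  have hdc : Continuous (deriv ψ) := hψ.continuous_deriv (by exact_mod_cast le_top)
  have hwc : Continuous fun ξ : ℝ => L ^ 2 + ξ ^ 2 := by fun_prop
  have hwne : ∀ ξ : ℝ, L ^ 2 + ξ ^ 2 ≠ 0 := fun ξ => by positivity
  have hv₁c : Continuous fun ξ => deriv ψ ξ / (L ^ 2 + ξ ^ 2) - 2 * ξ * ψ ξ / (L ^ 2 + ξ ^ 2) ^ 2 :=
    (hdc.div hwc hwne).sub (((continuous_const.mul continuous_id).mul hψc').div (hwc.pow 2) fun ξ => pow_ne_zero 2 (hwne ξ))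
  -- a support radius
  obtain ⟨r, hr⟩ := hψc.isCompact.isBounded.subset_ball 0
  have hzero : ∀ x, r ≤ |x| → ψ x = 0 ∧ deriv ψ x = 0 := by
    intro x hx
    have hx' : x ∉ tsupport ψ := fun h => by
      have hb := hr h
      rw [Metric.mem_ball, dist_zero_right, Real.norm_eq_abs] at hb
      linarith
    exact ⟨image_eq_zero_of_notMem_tsupport hx', notMem_support.1 fun h => hx' (support_deriv_subset h)⟩
  refine ⟨fun x => ?_, fun y => ?_, ?_, ⟨r, fun x hx => ?_⟩⟩
  · have h := intervalIntegral.integral_eq_sub_of_hasDerivAt (fun t _ => hd t) (hv₁c.intervalIntegrable 0 x)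
    show ψ x / (L ^ 2 + x ^ 2) = ψ 0 / (L ^ 2 + 0 ^ 2)
      + ∫ s in (0 : ℝ)..x, (deriv ψ s / (L ^ 2 + s ^ 2) - 2 * s * ψ s / (L ^ 2 + s ^ 2) ^ 2)
    linarith
  · show ψ (-y) / (L ^ 2 + (-y) ^ 2) = -(ψ y / (L ^ 2 + y ^ 2))
    rw [hodd, neg_sq]; ring
  · have hsupp : HasCompactSupport fun ξ => deriv ψ ξ / (L ^ 2 + ξ ^ 2) - 2 * ξ * ψ ξ / (L ^ 2 + ξ ^ 2) ^ 2 := by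
      refine HasCompactSupport.intro (isCompact_Icc : IsCompact (Icc (-r) r)) fun x hx => ?_
      have hrx : r ≤ |x| := by
        simp only [mem_Icc, not_and_or, not_le] at hx
        rcases hx with hx | hx
        · linarith [neg_abs_le x]
        · linarith [le_abs_self x]
      obtain ⟨h1, h2⟩ := hzero x hrx
      simp [h1, h2]
    exact hv₁c.memLp_of_hasCompactSupport hsupp
  · obtain ⟨h1, h2⟩ := hzero x hx
    simp [h1, h2]

omit hL in
/-- **`linForm` against `(ψ/w, (ψ/w)′)` is the unweighted pairing**: `∫ (u₁ψ′ + d u₁ψ + V uψ)` (pointwise identity of integrands;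
no integrability needed). [folklore] -/
theorem linForm_smooth_test (hL : 0 < L) (d V u u₁ ψ : ℝ → ℝ) :
    linForm L d V u u₁ (fun ξ => ψ ξ / (L ^ 2 + ξ ^ 2)) (fun ξ => deriv ψ ξ / (L ^ 2 + ξ ^ 2) - 2 * ξ * ψ ξ / (L ^ 2 + ξ ^ 2) ^ 2)
      = ∫ ξ, (u₁ ξ * deriv ψ ξ + d ξ * u₁ ξ * ψ ξ + V ξ * u ξ * ψ ξ) := by
  unfold linForm
  refine integral_congr_ae (Eventually.of_forall fun ξ => ?_)
  have hw : (L ^ 2 + ξ ^ 2) ≠ 0 := by positivity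
  field_simp
  ring

omit hL in
/-- `∫ w·f·(ψ/w) = ∫ f ψ`. [folklore] -/
theorem integral_weight_smooth_test (hL : 0 < L) (f ψ : ℝ → ℝ) :
    ∫ ξ, (L ^ 2 + ξ ^ 2) * (f ξ * (ψ ξ / (L ^ 2 + ξ ^ 2))) = ∫ ξ, f ξ * ψ ξ := by
  refine integral_congr_ae (Eventually.of_forall fun ξ => ?_)
  have hw : (L ^ 2 + ξ ^ 2) ≠ 0 := by positivity
  field_simp

/-- `L²(μ_w) ⊂ L²(dξ)` (`L > 0`). [folklore] -/
theorem memLp_volume_of_memLp_μw {f : ℝ → ℝ} (hf : MemLp f 2 (μw L)) : MemLp f 2 volume := by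
  have hm : AEStronglyMeasurable f volume := hf.1.mono_ac (volume_absolutelyContinuous_μw hL)
  have hf' := hf
  rw [μw_eq] at hf'
  exact memLp_two_of_weighted_sq hL hm ((memLp_two_withDensity_weight_iff hm).1 hf')

omit hL in
/-- `f ∈ L²`, `ψ` continuous with compact support ⇒ `f·ψ ∈ L¹`. [folklore] -/
theorem integrable_mul_of_memLp {f ψ : ℝ → ℝ} (hf : MemLp f 2 volume) (hψ : Continuous ψ) (hψc : HasCompactSupport ψ) :
    Integrable fun x => f x * ψ x := by
  simpa only [smul_eq_mul] using (hf.locallyIntegrable one_le_two).integrable_smul_right_of_hasCompactSupport hψ hψc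

end Tests

/-! ### §2 From the linearised weak equation to `weakZero_of_linearised`'s hypothesis, and (W) for `Ω̄ + δ` -/

section WeakZero

variable {Ω Ω₁ : ℝ → ℝ} {H₀ : ℝ} (hc : IsCentre 8 Ω Ω₁ H₀) {g₀ : W 8} {g₀f : ℝ → ℝ}
  (hg₀f : ((g₀ : W 8) : ℝ → ℝ) =ᵐ[volume] g₀f)
  (hres : ∀ ψ : ℝ → ℝ, ContDiff ℝ ∞ ψ → HasCompactSupport ψ → (∀ y, ψ (-y) = -ψ y) →
    ∫ x, g₀f x * ψ x = (∫ x, (Ω x + 1 / 2 * x * Ω₁ x + 1 / 5 * (∫ s in (0 : ℝ)..x, hilbertTransform Ω s) * Ω₁ x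
      - hilbertTransform Ω x * Ω x) * ψ x) + ∫ x, Ω₁ x * deriv ψ x)

include hc hg₀f hres in
/-- **The linearised weak equation implies `hlin`.**  If `δ ∈ Esp` solves `linForm(δ; v) = ∫ w·(Pδ − g₀ − Qδδ)·v` on compactly supported
tests and `g₀` represents `G(Ω̄)` weakly (`hres`), then for every ODD `ψ ∈ C_c^∞`:
`∫ L_Ω̄δ·ψ + ∫ δ₁ψ′ = −(P(Ω̄)[ψ] + ∫ Qδ·ψ)` in the notation of `SheetRWeakPairingExpansion` (`a = 1/5`, `ν = 1`). [folklore] -/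
theorem hlin_of_linearised_weak_eq {δ : Esp 8 eight_pos}
    (hweak : ∀ v v₁ : ℝ → ℝ, IsCompactTest v v₁ →
      linForm 8 (drift (1 / 5) Ω) (potential 8 4 Ω) (prim (der δ)) (der δ) v v₁ =
        ∫ y, ((8:ℝ) ^ 2 + y ^ 2) * ((PopFun 8 4 (1 / 5) Ω Ω₁ δ y - g₀f y - QFun 8 (1 / 5) δ δ y) * v y))
    (ψ : ℝ → ℝ) (hψ : ContDiff ℝ ∞ ψ) (hψc : HasCompactSupport ψ) (hψo : ∀ y, ψ (-y) = -ψ y) :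
    (∫ x, (prim (der δ) x + 1 / 2 * x * der δ x
        + 1 / 5 * ((∫ s in (0 : ℝ)..x, hilbertTransform Ω s) * der δ x + (∫ s in (0 : ℝ)..x, hilbertTransform (prim (der δ)) s) * Ω₁ x)
        - (hilbertTransform Ω x * prim (der δ) x + hilbertTransform (prim (der δ)) x * Ω x)) * ψ x) + 1 * ∫ x, der δ x * deriv ψ x
      = -(((∫ x, (Ω x + 1 / 2 * x * Ω₁ x + 1 / 5 * (∫ s in (0 : ℝ)..x, hilbertTransform Ω s) * Ω₁ x
              - hilbertTransform Ω x * Ω x) * ψ x) + 1 * ∫ x, Ω₁ x * deriv ψ x)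
          + ∫ x, (1 / 5 * (∫ s in (0 : ℝ)..x, hilbertTransform (prim (der δ)) s) * der δ x
              - hilbertTransform (prim (der δ)) x * prim (der δ) x) * ψ x) := by
  have h8 : (0:ℝ) < 8 := eight_pos
  -- the linearised weak equation tested with `(ψ/w, (ψ/w)′)`
  have h := hweak _ _ (isCompactTest_of_smooth_odd h8 hψ hψc hψo)
  rw [linForm_smooth_test h8, integral_weight_smooth_test h8] at h
  -- regularity of the pieces
  obtain ⟨hΩc, hΩ₁2, hΩ2, hΩi, -⟩ := hc.basic h8
  obtain ⟨hδ₁2, hδi, hδ2⟩ := basic_of_mem h8 δ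
  obtain ⟨hu, -, -, -, -, -⟩ := profile_of_mem h8 δ
  have hψc' : Continuous ψ := hψ.continuous
  have hdψc : Continuous (deriv ψ) := hψ.continuous_deriv (by exact_mod_cast le_top)
  have hdψs : HasCompactSupport (deriv ψ) := hψc.deriv
  have hUc : Continuous fun ξ => ∫ s in (0 : ℝ)..ξ, hilbertTransform Ω s := continuous_velocity_of_primitive hc.primitive' hΩ₁2 hΩi hΩ2
  have hdc : Continuous (drift (1 / 5) Ω) := (by fun_prop : Continuous fun ξ : ℝ => ξ / 2).add (continuous_const.mul hUc)
  have hHc : Continuous (hilbertTransform Ω) := SheetRVelocityEndpointClass.continuous_hilbertTransform_of_primitive hc.primitive' hΩ₁2 hΩi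
  have hVc : Continuous (potential 8 4 Ω) := by
    refine (continuous_const.sub hHc).add (continuous_const.mul (continuous_const.div (by fun_prop) fun ξ => ?_))
    positivity
  have hδc : Continuous (prim (der δ)) := continuous_prim h8 _
  have i1 : Integrable fun x => der δ x * deriv ψ x := integrable_mul_of_memLp hδ₁2 hdψc hdψs
  have i2 : Integrable fun x => drift (1 / 5) Ω x * der δ x * ψ x := by
    have := integrable_mul_of_memLp hδ₁2 (hdc.mul hψc') (hψc.mul_left (f := drift (1 / 5) Ω))
    exact this.congr (Eventually.of_forall fun x => by simp only [Pi.mul_apply]; ring)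
  have i3 : Integrable fun x => potential 8 4 Ω x * prim (der δ) x * ψ x := by
    have := integrable_mul_of_memLp hδ2 (hVc.mul hψc') (hψc.mul_left (f := potential 8 4 Ω))
    exact this.congr (Eventually.of_forall fun x => by simp only [Pi.mul_apply]; ring)
  have i4 : Integrable fun x => PopFun 8 4 (1 / 5) Ω Ω₁ δ x * ψ x :=
    integrable_mul_of_memLp (memLp_volume_of_memLp_μw h8
      (memLp_PopFun h8 4 (1 / 5) hΩc.aestronglyMeasurable (by positivity) (hc.basic h8).2.2.2.2 hc.measurable hc.weight₁ δ).1) hψc' hψc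
  have i5 : Integrable fun x => g₀f x * ψ x :=
    integrable_mul_of_memLp (memLp_volume_of_memLp_μw h8 ((Lp.memLp g₀).ae_eq (ae_μw_of_ae_volume hg₀f))) hψc' hψc
  have i6 : Integrable fun x => QFun 8 (1 / 5) δ δ x * ψ x :=
    integrable_mul_of_memLp (memLp_volume_of_memLp_μw h8 (memLp_QFun h8 (1 / 5) δ δ).1) hψc' hψc
  -- split both sides of the tested equation
  have hL : ∫ ξ, (der δ ξ * deriv ψ ξ + drift (1 / 5) Ω ξ * der δ ξ * ψ ξ + potential 8 4 Ω ξ * prim (der δ) ξ * ψ ξ)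
      = (∫ x, der δ x * deriv ψ x) + (∫ x, drift (1 / 5) Ω x * der δ x * ψ x) + ∫ x, potential 8 4 Ω x * prim (der δ) x * ψ x := by
    have i12 : Integrable fun x => der δ x * deriv ψ x + drift (1 / 5) Ω x * der δ x * ψ x := i1.add i2
    rw [integral_add i12 i3, integral_add i1 i2]
  have hR : ∫ ξ, (PopFun 8 4 (1 / 5) Ω Ω₁ δ ξ - g₀f ξ - QFun 8 (1 / 5) δ δ ξ) * ψ ξ
      = (∫ x, PopFun 8 4 (1 / 5) Ω Ω₁ δ x * ψ x) - (∫ x, g₀f x * ψ x) - ∫ x, QFun 8 (1 / 5) δ δ x * ψ x := by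
    have i45 : Integrable fun x => PopFun 8 4 (1 / 5) Ω Ω₁ δ x * ψ x - g₀f x * ψ x := i4.sub i5
    rw [← integral_sub i4 i5, ← integral_sub i45 i6]
    exact integral_congr_ae (Eventually.of_forall fun x => by ring)
  rw [hL, hR] at h
  -- the linearisation integrand is `d δ₁ + V δ − P δ`, pointwise
  have hlinear : ∫ x, (prim (der δ) x + 1 / 2 * x * der δ x
        + 1 / 5 * ((∫ s in (0 : ℝ)..x, hilbertTransform Ω s) * der δ x + (∫ s in (0 : ℝ)..x, hilbertTransform (prim (der δ)) s) * Ω₁ x)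
        - (hilbertTransform Ω x * prim (der δ) x + hilbertTransform (prim (der δ)) x * Ω x)) * ψ x
      = (∫ x, drift (1 / 5) Ω x * der δ x * ψ x) + (∫ x, potential 8 4 Ω x * prim (der δ) x * ψ x)
          - ∫ x, PopFun 8 4 (1 / 5) Ω Ω₁ δ x * ψ x := by
    have i23 : Integrable fun x => drift (1 / 5) Ω x * der δ x * ψ x + potential 8 4 Ω x * prim (der δ) x * ψ x := i2.add i3
    rw [← integral_add i2 i3, ← integral_sub i23 i4]
    refine integral_congr_ae (Eventually.of_forall fun x => ?_)
    simp only [drift, potential, PopFun]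
    have hw : ((8:ℝ) ^ 2 + x ^ 2) ≠ 0 := by positivity
    field_simp
    ring
  have hQ : ∫ x, (1 / 5 * (∫ s in (0 : ℝ)..x, hilbertTransform (prim (der δ)) s) * der δ x
      - hilbertTransform (prim (der δ)) x * prim (der δ) x) * ψ x = ∫ x, QFun 8 (1 / 5) δ δ x * ψ x := by
    simp only [QFun]
  rw [hlinear, hQ]
  have hr := hres ψ hψ hψc hψo
  linarith

include hc hg₀f hres in
/-- **(W) for the certified profile.**  Under the same hypotheses, `Ω* := Ω̄ + prim (der δ)` with `Ω*₁ := Ω̄₁ + der δ` satisfies the weak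
profile equation of `G(Ω) = Ω + ½ξΩ′ + (1/5)𝒰Ω·Ω′ − (HΩ)Ω − Ω″` against every odd `C_c^∞` test. [folklore] -/
theorem weakZero_of_linearised_weak_eq {δ : Esp 8 eight_pos}
    (hweak : ∀ v v₁ : ℝ → ℝ, IsCompactTest v v₁ →
      linForm 8 (drift (1 / 5) Ω) (potential 8 4 Ω) (prim (der δ)) (der δ) v v₁ =
        ∫ y, ((8:ℝ) ^ 2 + y ^ 2) * ((PopFun 8 4 (1 / 5) Ω Ω₁ δ y - g₀f y - QFun 8 (1 / 5) δ δ y) * v y)) :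
    ∀ ψ : ℝ → ℝ, ContDiff ℝ ∞ ψ → HasCompactSupport ψ → (∀ y, ψ (-y) = -ψ y) →
      (∫ x, ((Ω x + prim (der δ) x) + 1 / 2 * x * (Ω₁ x + der δ x)
          + 1 / 5 * (∫ s in (0 : ℝ)..x, hilbertTransform (fun y => Ω y + prim (der δ) y) s) * (Ω₁ x + der δ x)
          - hilbertTransform (fun y => Ω y + prim (der δ) y) x * (Ω x + prim (der δ) x)) * ψ x)
        + 1 * ∫ x, (Ω₁ x + der δ x) * deriv ψ x = 0 := by
  have h8 : (0:ℝ) < 8 := eight_pos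
  obtain ⟨-, hΩ₁2, hΩ2, hΩi, -⟩ := hc.basic h8
  obtain ⟨hδ₁2, hδi, hδ2⟩ := basic_of_mem h8 δ
  obtain ⟨hu, -, -, -, -, -⟩ := profile_of_mem h8 δ
  exact weakZero_of_linearised (T := fun ψ => ∀ y, ψ (-y) = -ψ y) hc.primitive' hΩ₁2 hΩi hΩ2 hu hδ₁2 hδi hδ2
    (fun ψ hψ hψc hψo => hlin_of_linearised_weak_eq hc hg₀f hres hweak ψ hψ hψc hψo)

end WeakZero

/-! ### §3 The MODEL blow-up from the assembled certificate -/

section Blowup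

variable {Ω Ω₁ : ℝ → ℝ} {H₀ : ℝ} (hc : IsCentre 8 Ω Ω₁ H₀)
  (S₀ : W 8 →L[ℝ] Esp 8 eight_pos)
  (hS₀ : ∀ (g : W 8) (v v₁ : ℝ → ℝ), IsCompactTest v v₁ →
    linForm 8 (drift (1 / 5) Ω) (potential 8 4 Ω) (prim (der (S₀ g))) (der (S₀ g)) v v₁ = ∫ y, ((8:ℝ) ^ 2 + y ^ 2) * ((g : ℝ → ℝ) y * v y))
  (M : Esp 8 eight_pos →L[ℝ] Esp 8 eight_pos)
  (hM₁ : ∀ x, M x - S₀ (PopC eight_pos 4 (1 / 5) hc (M x)) = x)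
  (hK : ∀ g, ‖M (S₀ g)‖ ≤ ((KNw / (1 - KNw * epsN) : ℚ) : ℝ) * ‖g‖)
  (g₀ : W 8) (hη : ‖g₀‖ ≤ (eta : ℝ)) {g₀f : ℝ → ℝ} (hg₀f : ((g₀ : W 8) : ℝ → ℝ) =ᵐ[volume] g₀f)
  (hres : ∀ ψ : ℝ → ℝ, ContDiff ℝ ∞ ψ → HasCompactSupport ψ → (∀ y, ψ (-y) = -ψ y) →
    ∫ x, g₀f x * ψ x = (∫ x, (Ω x + 1 / 2 * x * Ω₁ x + 1 / 5 * (∫ s in (0 : ℝ)..x, hilbertTransform Ω s) * Ω₁ x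
      - hilbertTransform Ω x * Ω x) * ψ x) + ∫ x, Ω₁ x * deriv ψ x)

include hc in
/-- The profile `Ω* = Ω̄ + prim (der δ)`: continuous, odd, `L¹ ∩ L²`, `Ω* = ∫₀ Ω*₁` with `Ω*₁ = Ω̄₁ + der δ ∈ L²`, its weak derivative is `Ω*₁`,
and `|prim (der δ)| ≤ (√2/8)‖δ‖`. [folklore] -/
theorem profile_facts (δ : Esp 8 eight_pos) :
    Continuous (fun y => Ω y + prim (der δ) y) ∧ (∀ y, Ω (-y) + prim (der δ) (-y) = -(Ω y + prim (der δ) y)) ∧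
    Integrable (fun y => Ω y + prim (der δ) y) ∧ MemLp (fun y => Ω y + prim (der δ) y) 2 volume ∧
    MemLp (fun y => Ω₁ y + der δ y) 2 volume ∧
    (∀ ψ : ℝ → ℝ, ContDiff ℝ ∞ ψ → HasCompactSupport ψ →
      ∫ x, (Ω x + prim (der δ) x) * deriv ψ x = -∫ x, (Ω₁ x + der δ x) * ψ x) ∧
    ∀ y, |prim (der δ) y| ≤ Real.sqrt 2 / 8 * ‖δ‖ := by
  have h8 : (0:ℝ) < 8 := eight_pos
  obtain ⟨hΩc, hΩ₁2, hΩ2, hΩi, -⟩ := hc.basic h8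
  obtain ⟨hδ₁2, hδi, hδ2⟩ := basic_of_mem h8 δ
  obtain ⟨-, hodd, hm, h0, h1, -⟩ := profile_of_mem h8 δ
  have hδc : Continuous (prim (der δ)) := continuous_prim h8 _
  have hsum : ∀ x, Ω x + prim (der δ) x = ∫ s in (0 : ℝ)..x, (Ω₁ s + der δ s) := fun x => by
    rw [intervalIntegral.integral_add (intervalIntegrable_of_memLp_two hΩ₁2 0 x) (intervalIntegrable_of_memLp_two hδ₁2 0 x),
      ← hc.primitive x, prim_apply]
  refine ⟨hΩc.add hδc, fun y => by rw [hc.odd, hodd]; ring, hΩi.add hδi, hΩ2.add hδ2, hΩ₁2.add hδ₁2, fun ψ hψ hψc => ?_, fun y => ?_⟩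
  · have hF : LocallyIntegrable fun s => Ω₁ s + der δ s := (hΩ₁2.add hδ₁2).locallyIntegrable one_le_two
    have h := integral_deriv_mul_primitive hF hψ hψc
    calc ∫ x, (Ω x + prim (der δ) x) * deriv ψ x = ∫ x, deriv ψ x * ∫ s in (0 : ℝ)..x, (Ω₁ s + der δ s) :=
          integral_congr_ae (Eventually.of_forall fun x => by
            show (Ω x + prim (der δ) x) * deriv ψ x = deriv ψ x * ∫ s in (0 : ℝ)..x, (Ω₁ s + der δ s)
            rw [hsum x, mul_comm])
      _ = -∫ x, (Ω₁ x + der δ x) * ψ x := by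
          rw [h]; exact congrArg Neg.neg (integral_congr_ae (Eventually.of_forall fun x => mul_comm _ _))
  · have h := abs_le_sqrt_two_div_mul_energy_of_primitive h8 (profile_of_mem h8 δ).1 hm h0 h1 y
    rwa [sqrt_energy_eq_norm h8 δ] at h

include hc hS₀ hM₁ hK hη hg₀f hres in
/-- **THE ASSEMBLED CERTIFICATE, END TO END (MODEL blow-up).**  Centre `Ω̄` in the odd energy class with `|HΩ̄| ≤ H₀` and
`|Ω̄(X₀)| > (√2/8)·rE` at some point; `S₀` any solution operator of `B_λ` on compactly supported tests (exists under (C1) by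
`exists_solutionOperator`); (C2)/(C3): `M` a right inverse of `1 − S₀∘P` with `‖M (S₀ g)‖_E ≤ K_w‖g‖_w`, `K_w = KNw/(1 − KNw·epsN)`; residual
`g₀ ∈ L²_w`, `‖g₀‖ ≤ eta`, representing `G(Ω̄)` weakly (`hres`).  THEN: there is exactly one `δ` in the closed `E`-ball of radius `rE` with
`δ = −(M∘S₀)(g₀ + Qδδ)`; the profile `Ω* := Ω̄ + prim (der δ)` is `C²`; and for every `T > 0` the exact self-similar function
`ω(t,x) = (T − t)⁻¹ Ω*(x/√(T − t))` is a classical solution of the viscous gCLM `ω_t + (1/5)uω_x = u_xω + ω_xx` on `ℝ × [0,T)` whose sup norm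
blows up as `t ↑ T` (uniqueness among weak solutions, which needs (C1) and the left inverse property, is
`SheetRCertificateAssembly.existsUnique_linearised_weakSolution`).  A statement about a 1-D MODEL; interval arithmetic = hypotheses;
NOT Navier–Stokes. [folklore] -/
theorem modelBlowup_of_certificate {X₀ : ℝ} (hX₀ : Real.sqrt 2 / 8 * (rE : ℝ) < |Ω X₀|) {T : ℝ} (hT : 0 < T) :
    ∃ δ ∈ closedBall (0 : Esp 8 eight_pos) (rE : ℝ),
      δ = -(M.comp S₀) (g₀ + Qop eight_pos (1 / 5) δ δ) ∧
      (∀ δ' ∈ closedBall (0 : Esp 8 eight_pos) (rE : ℝ), δ' = -(M.comp S₀) (g₀ + Qop eight_pos (1 / 5) δ' δ') → δ' = δ) ∧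
      ContDiff ℝ 2 (fun y => Ω y + prim (der δ) y) ∧
      IsGCLMLineSolution (1 / 5) 1 (gclmSelfSimilar (-1) (1 / 2) T (fun y => Ω y + prim (der δ) y)) T ∧
      SupNormBlowupBefore (gclmSelfSimilar (-1) (1 / 2) T (fun y => Ω y + prim (der δ) y)) T := by
  obtain ⟨δ, hball, hfix, huniq⟩ := existsUnique_fixedPoint_assembled (M.comp S₀) (fun g => hK g) g₀ hη
  refine ⟨δ, hball, hfix, huniq, ?_⟩
  obtain ⟨hc', hodd, hi, h2, h₁2, hwd, hsup⟩ := profile_facts hc δ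
  have hweak : ∀ v v₁ : ℝ → ℝ, IsCompactTest v v₁ →
      linForm 8 (drift (1 / 5) Ω) (potential 8 4 Ω) (prim (der δ)) (der δ) v v₁ =
        ∫ y, ((8:ℝ) ^ 2 + y ^ 2) * ((PopFun 8 4 (1 / 5) Ω Ω₁ δ y - g₀f y - QFun 8 (1 / 5) δ δ y) * v y) :=
    fun v v₁ hv => linearised_weak_eq_of_fixedPoint hc S₀ hS₀ M hM₁ g₀ hg₀f hfix hv
  have hW := weakZero_of_linearised_weak_eq hc hg₀f hres hweak
  -- `Ω* ≢ 0`: at `X₀` the centre dominates the correction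
  have hne : ¬ (fun y => Ω y + prim (der δ) y) =ᵐ[volume] (0 : ℝ → ℝ) := by
    intro hae
    have h0 : (fun y => Ω y + prim (der δ) y) = 0 := (Continuous.ae_eq_iff_eq volume hc' continuous_const).1 hae
    have hX : Ω X₀ + prim (der δ) X₀ = 0 := congrFun h0 X₀
    have hδn : ‖δ‖ ≤ (rE : ℝ) := by rwa [mem_closedBall, dist_zero_right] at hball
    have h1 : |Ω X₀| ≤ Real.sqrt 2 / 8 * ‖δ‖ := by
      rw [show Ω X₀ = -prim (der δ) X₀ by linarith, abs_neg]; exact hsup X₀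
    have h2' : Real.sqrt 2 / 8 * ‖δ‖ ≤ Real.sqrt 2 / 8 * (rE : ℝ) := mul_le_mul_of_nonneg_left hδn (by positivity)
    linarith
  obtain ⟨Ω', hae, -, hC2, hsol, hblow⟩ := SheetRWeakZeroParity.exact_viscous_selfSimilar_blowup_of_weakDeriv_odd (a := 1 / 5) hT
    one_ne_zero hi h2 h₁2 (Eventually.of_forall hodd) hne hwd hW
  -- the `C²` representative is `Ω*` itself (both are continuous)
  have heq : Ω' = fun y => Ω y + prim (der δ) y := (Continuous.ae_eq_iff_eq volume hC2.continuous hc').1 hae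
  subst heq
  exact ⟨hC2, hsol, hblow⟩

end Blowup

end SheetRCertificateWeakZero
end Summit.NavierStokesRegularity.OSWSelfSimilar

end
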